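import Summits.Parity.GeneralizedHardyLittlewood.Theorems.PrimeLevelFamEdgeMomentsBeyondDiagonalDiagDecorM4Block
import Summits.Parity.GeneralizedHardyLittlewood.Theorems.PrimeLevelFamEdgeMomentsBeyondDiagonalDiagDecorOrderTwoTwoPoly
import HarnessLib

/-!
# Route `PrimeLevelFamEdge`, crux K_A `MomentsBeyondDiagonal` (stmt-Parity-20007), line «petersson_layers» v4, stub `stub_diag`:
# **THE `M₄`-FAMILY BOUNDS (M4) ARE PROVED** (`|Sel(τ(3P₂²−2P₄)(k_i)·τ·L^m)| ≤ C log M`, `m ≤ 1`) — the hypothesis `hM4` of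
# `…DiagDecorOrderTwoTwoPoly.orderTwoTwoPoly_of_M4` and `…DiagRungTwoOfM4`

Last layer of the `M₄ = τ(3P₂² − 2P₄)`-engine: from the crude block bound `…DiagDecorM4Block.abs_selbergBlockM4_le`
(`|Sel(τDℓ⁺₁^{r₁}·τℓ⁺₂^{r₂}·B^p)| ≤ C log^{p+r₁+r₂}M`) by `L = 2B + ℓ⁺(k₁) + ℓ⁺(k₂)` (as in `…ShiftedP2Lpow`) and the
`k₁ ↔ k₂` symmetry of the Selberg form:

* `tauM4Tau_Lpow_eq_sum_blocks` — the pointwise block expansion of `τD(k₁)·τ(k₂)·L^m`;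
* `abs_selbergM4Lpow_le`, `abs_selbergM4Lpow_le'` — `|Sel(τ(3P₂²−2P₄)(k₁)·τ(k₂)·L^m)| ≤ C·log^mM` and the mirror, every `m`;
* `M4_bounds` — **(M4)**: the hypothesis `hM4` of `…DiagDecorOrderTwoTwoPoly.orderTwoTwoPoly_of_M4` (`m ≤ 1`, `≤ C log M`).

(Poly₂₂) unconditional and rung 2 ⟸ (R₂₂) follow in `…DiagRungTwoOfR22`. Def-free; theorems only. Helper
`--supports stmt-Parity-20007`; closes nothing; K_A, K_B and the Parity summit are NOT proved; nothing about Landau–Siegel zeros.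

## References
* E. Kowalski, P. Michel, J. VanderKam, J. reine angew. Math. 526 (2000), (23)–(28) pp. 13–15 and Prop. 5.1 p. 18.
  [cite: KowalskiMichelVanderKam2000, (23)–(28) — derivation (diagonal main term in real Selberg coordinates, rung 2)]
-/

noncomputable section

open scoped Real ArithmeticFunction.Moebius
open Finset ArithmeticFunction Polynomial MeasureTheory intervalIntegral

namespace Summit.Parity.GeneralizedHardyLittlewood.Theorems.MomentsBeyondDiagonal.DiagKernel

open Literature.NumberTheory.LFunctions Literature.NumberTheory.LFunctions.KMV2000
open Literature.NumberTheory.Sieve (one_le_log_of_three_le)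

/-- **Pointwise block expansion** (`M > 0`, `c, g, k₁, k₂ ≥ 1`; `ℓ⁺(k) = log((M/(cg))/k)`, `B = λlog M − log g − log(M/(cg))`,
`D = 3P₂² − 2P₄`): `τ(k₁)D(k₁)τ(k₂)L^m = Σ_{j≤m}Σ_{i≤j} C(m,j)C(j,i)2^{m−j}(τD(k₁)ℓ⁺(k₁)^i)(τ(k₂)ℓ⁺(k₂)^{j−i})B^{m−j}`.
[cite: KowalskiMichelVanderKam2000, (23) — derivation] -/
theorem tauM4Tau_Lpow_eq_sum_blocks {M : ℝ} (hM : 0 < M) (lam : ℝ) (m : ℕ) {c g k₁ k₂ : ℕ} (hc : c ≠ 0)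
    (hg : g ≠ 0) (hk₁ : k₁ ≠ 0) (hk₂ : k₂ ≠ 0) :
    (k₁.divisors.card : ℝ) * (3 * (∑ q ∈ k₁.primeFactors, Real.log q ^ 2) ^ 2 - 2 * ∑ q ∈ k₁.primeFactors, Real.log q ^ 4) *
        (k₂.divisors.card : ℝ) * (2 * (lam * Real.log M) - 2 * Real.log g - Real.log k₁ - Real.log k₂) ^ m =
      ∑ j ∈ Finset.range (m + 1), ∑ i ∈ Finset.range (j + 1),
        (m.choose j : ℝ) * (j.choose i : ℝ) * 2 ^ (m - j) *
          (((k₁.divisors.card : ℝ) *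
                  (3 * (∑ q ∈ k₁.primeFactors, Real.log q ^ 2) ^ 2 - 2 * ∑ q ∈ k₁.primeFactors, Real.log q ^ 4) *
                  Real.log (M / ((c * g : ℕ) : ℝ) / k₁) ^ i) *
                ((k₂.divisors.card : ℝ) * Real.log (M / ((c * g : ℕ) : ℝ) / k₂) ^ (j - i)) *
                (lam * Real.log M - Real.log g - Real.log (M / ((c * g : ℕ) : ℝ))) ^ (m - j)) := by
  have hcg : (0 : ℝ) < ((c * g : ℕ) : ℝ) := by exact_mod_cast Nat.pos_of_ne_zero (mul_ne_zero hc hg)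
  have hY : M / ((c * g : ℕ) : ℝ) ≠ 0 := (div_pos hM hcg).ne'
  have h1 : Real.log (M / ((c * g : ℕ) : ℝ) / k₁) = Real.log (M / ((c * g : ℕ) : ℝ)) - Real.log k₁ :=
    Real.log_div hY (by exact_mod_cast hk₁)
  have h2 : Real.log (M / ((c * g : ℕ) : ℝ) / k₂) = Real.log (M / ((c * g : ℕ) : ℝ)) - Real.log k₂ :=
    Real.log_div hY (by exact_mod_cast hk₂)
  have hL : (2 * (lam * Real.log M) - 2 * Real.log g - Real.log k₁ - Real.log k₂) =
      (Real.log (M / ((c * g : ℕ) : ℝ) / k₁) + Real.log (M / ((c * g : ℕ) : ℝ) / k₂)) +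
        2 * (lam * Real.log M - Real.log g - Real.log (M / ((c * g : ℕ) : ℝ))) := by
    rw [h1, h2]; ring
  rw [hL, add_pow, Finset.mul_sum]
  refine Finset.sum_congr rfl fun j _ ↦ ?_
  rw [add_pow, mul_pow, Finset.sum_mul, Finset.sum_mul, Finset.mul_sum]
  refine Finset.sum_congr rfl fun i _ ↦ ?_
  ring

/-- **`|Sel(τ(3P₂²−2P₄)(k₁)·τ(k₂)·L^m)| ≤ C·log^m M`** for every `m` (`0 ≤ λ ≤ 1`, `P₀ = P₁ = 0`, `M ≥ 3`).
[cite: KowalskiMichelVanderKam2000, (23)–(28) — derivation] -/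
theorem abs_selbergM4Lpow_le (P : ℝ[X]) (hP0 : P.coeff 0 = 0) (hP1 : P.coeff 1 = 0) (m : ℕ)
    {lam : ℝ} (hlam0 : 0 ≤ lam) (hlam1 : lam ≤ 1) :
    ∃ C : ℝ, 0 < C ∧ ∀ M : ℝ, 3 ≤ M →
      |∑ c ∈ Icc 1 ⌊M⌋₊, ∑ g ∈ Icc 1 (⌊M⌋₊ / c), (μ g : ℝ) * c *
          ∑ k₁ ∈ Icc 1 (⌊M⌋₊ / (c * g)), ∑ k₂ ∈ Icc 1 (⌊M⌋₊ / (c * g)),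
            ((μ (c * g * k₁) : ℝ) * ((psi (c * g * k₁))⁻¹ *
                P.eval (Real.log (M / ((c * g * k₁ : ℕ) : ℝ)) / Real.log M))) / ((c * g * k₁ : ℕ) : ℝ) *
              (((μ (c * g * k₂) : ℝ) * ((psi (c * g * k₂))⁻¹ *
                P.eval (Real.log (M / ((c * g * k₂ : ℕ) : ℝ)) / Real.log M))) / ((c * g * k₂ : ℕ) : ℝ)) *
              ((k₁.divisors.card : ℝ) * (3 * (∑ p ∈ k₁.primeFactors, Real.log p ^ 2) ^ 2 - 2 * ∑ p ∈ k₁.primeFactors, Real.log p ^ 4) *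
                (k₂.divisors.card : ℝ) * (2 * (lam * Real.log M) - 2 * Real.log g - Real.log k₁ - Real.log k₂) ^ m)| ≤
        C * Real.log M ^ m := by
  have hex : ∀ j i : ℕ, ∃ C : ℝ, 0 < C ∧ ∀ M : ℝ, 3 ≤ M →
      |∑ c ∈ Icc 1 ⌊M⌋₊, ∑ g ∈ Icc 1 (⌊M⌋₊ / c), (μ g : ℝ) * c *
          ∑ k₁ ∈ Icc 1 (⌊M⌋₊ / (c * g)), ∑ k₂ ∈ Icc 1 (⌊M⌋₊ / (c * g)),
            ((μ (c * g * k₁) : ℝ) * ((psi (c * g * k₁))⁻¹ *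
                P.eval (Real.log (M / ((c * g * k₁ : ℕ) : ℝ)) / Real.log M))) / ((c * g * k₁ : ℕ) : ℝ) *
              (((μ (c * g * k₂) : ℝ) * ((psi (c * g * k₂))⁻¹ *
                P.eval (Real.log (M / ((c * g * k₂ : ℕ) : ℝ)) / Real.log M))) / ((c * g * k₂ : ℕ) : ℝ)) *
              (((k₁.divisors.card : ℝ) *
                  (3 * (∑ q ∈ k₁.primeFactors, Real.log q ^ 2) ^ 2 - 2 * ∑ q ∈ k₁.primeFactors, Real.log q ^ 4) *
                  Real.log (M / ((c * g : ℕ) : ℝ) / k₁) ^ i) *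
                ((k₂.divisors.card : ℝ) * Real.log (M / ((c * g : ℕ) : ℝ) / k₂) ^ (j - i)) *
                (lam * Real.log M - Real.log g - Real.log (M / ((c * g : ℕ) : ℝ))) ^ (m - j))| ≤
        C * Real.log M ^ ((m - j) + i + (j - i)) := by
    intro j i
    exact abs_selbergBlockM4_le P hP0 hP1 (m - j) i (j - i) hlam0 hlam1
  choose Cb hCb0 hCb using hex
  set K : ℝ := ∑ j ∈ Finset.range (m + 1), ∑ i ∈ Finset.range (j + 1),
    (m.choose j : ℝ) * (j.choose i : ℝ) * 2 ^ (m - j) * Cb j i with hK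
  have hK0 : 0 ≤ K := Finset.sum_nonneg fun j _ ↦ Finset.sum_nonneg fun i _ ↦ by
    have := hCb0 j i; positivity
  refine ⟨K + 1, by positivity, fun M hM ↦ ?_⟩
  have hℓ1 : 1 ≤ Real.log M := one_le_log_of_three_le hM
  have hM0 : 0 < M := by linarith
  -- Step 1: expand the weight pointwise and use linearity
  have hpt : ∀ c ∈ Icc 1 ⌊M⌋₊, ∀ g ∈ Icc 1 (⌊M⌋₊ / c), ∀ k₁ ∈ Icc 1 (⌊M⌋₊ / (c * g)), ∀ k₂ ∈ Icc 1 (⌊M⌋₊ / (c * g)),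
      ((μ (c * g * k₁) : ℝ) * ((psi (c * g * k₁))⁻¹ *
          P.eval (Real.log (M / ((c * g * k₁ : ℕ) : ℝ)) / Real.log M))) / ((c * g * k₁ : ℕ) : ℝ) *
        (((μ (c * g * k₂) : ℝ) * ((psi (c * g * k₂))⁻¹ *
          P.eval (Real.log (M / ((c * g * k₂ : ℕ) : ℝ)) / Real.log M))) / ((c * g * k₂ : ℕ) : ℝ)) *
        ((k₁.divisors.card : ℝ) * (3 * (∑ p ∈ k₁.primeFactors, Real.log p ^ 2) ^ 2 - 2 * ∑ p ∈ k₁.primeFactors, Real.log p ^ 4) *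
                (k₂.divisors.card : ℝ) * (2 * (lam * Real.log M) - 2 * Real.log g - Real.log k₁ - Real.log k₂) ^ m) =
      ((μ (c * g * k₁) : ℝ) * ((psi (c * g * k₁))⁻¹ *
          P.eval (Real.log (M / ((c * g * k₁ : ℕ) : ℝ)) / Real.log M))) / ((c * g * k₁ : ℕ) : ℝ) *
        (((μ (c * g * k₂) : ℝ) * ((psi (c * g * k₂))⁻¹ *
          P.eval (Real.log (M / ((c * g * k₂ : ℕ) : ℝ)) / Real.log M))) / ((c * g * k₂ : ℕ) : ℝ)) *
        ∑ j ∈ Finset.range (m + 1), (fun (j c g k₁ k₂ : ℕ) ↦ ∑ i ∈ Finset.range (j + 1),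
          (m.choose j : ℝ) * (j.choose i : ℝ) * 2 ^ (m - j) *
          (((k₁.divisors.card : ℝ) *
                  (3 * (∑ q ∈ k₁.primeFactors, Real.log q ^ 2) ^ 2 - 2 * ∑ q ∈ k₁.primeFactors, Real.log q ^ 4) *
                  Real.log (M / ((c * g : ℕ) : ℝ) / k₁) ^ i) *
                ((k₂.divisors.card : ℝ) * Real.log (M / ((c * g : ℕ) : ℝ) / k₂) ^ (j - i)) *
                (lam * Real.log M - Real.log g - Real.log (M / ((c * g : ℕ) : ℝ))) ^ (m - j))) j c g k₁ k₂ := by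
    intro c hc g hg k₁ hk₁ k₂ hk₂
    have hc0 : c ≠ 0 := by have := (Finset.mem_Icc.1 hc).1; omega
    have hg0 : g ≠ 0 := by have := (Finset.mem_Icc.1 hg).1; omega
    have hk₁0 : k₁ ≠ 0 := by have := (Finset.mem_Icc.1 hk₁).1; omega
    have hk₂0 : k₂ ≠ 0 := by have := (Finset.mem_Icc.1 hk₂).1; omega
    rw [tauM4Tau_Lpow_eq_sum_blocks hM0 lam m hc0 hg0 hk₁0 hk₂0]
  rw [Finset.sum_congr rfl fun c hc ↦ Finset.sum_congr rfl fun g hg ↦ congrArg _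
    (Finset.sum_congr rfl fun k₁ hk₁ ↦ Finset.sum_congr rfl fun k₂ hk₂ ↦ hpt c hc g hg k₁ hk₁ k₂ hk₂),
    selbergProd_finset_sum P M (Finset.range (m + 1))]
  rw [Finset.sum_congr rfl fun j _ ↦ selbergProd_finset_sum P M (Finset.range (j + 1))
    (fun (i c g k₁ k₂ : ℕ) ↦ (m.choose j : ℝ) * (j.choose i : ℝ) * 2 ^ (m - j) *
      (((k₁.divisors.card : ℝ) *
                  (3 * (∑ q ∈ k₁.primeFactors, Real.log q ^ 2) ^ 2 - 2 * ∑ q ∈ k₁.primeFactors, Real.log q ^ 4) *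
                  Real.log (M / ((c * g : ℕ) : ℝ) / k₁) ^ i) *
                ((k₂.divisors.card : ℝ) * Real.log (M / ((c * g : ℕ) : ℝ) / k₂) ^ (j - i)) *
                (lam * Real.log M - Real.log g - Real.log (M / ((c * g : ℕ) : ℝ))) ^ (m - j)))]
  simp only [selbergProd_const_mul]
  -- Step 2: termwise crude bounds
  have hterm : ∀ j ∈ Finset.range (m + 1),
      |∑ i ∈ Finset.range (j + 1), (m.choose j : ℝ) * (j.choose i : ℝ) * 2 ^ (m - j) *
          ∑ c ∈ Icc 1 ⌊M⌋₊, ∑ g ∈ Icc 1 (⌊M⌋₊ / c), (μ g : ℝ) * c *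
          ∑ k₁ ∈ Icc 1 (⌊M⌋₊ / (c * g)), ∑ k₂ ∈ Icc 1 (⌊M⌋₊ / (c * g)),
            ((μ (c * g * k₁) : ℝ) * ((psi (c * g * k₁))⁻¹ *
                P.eval (Real.log (M / ((c * g * k₁ : ℕ) : ℝ)) / Real.log M))) / ((c * g * k₁ : ℕ) : ℝ) *
              (((μ (c * g * k₂) : ℝ) * ((psi (c * g * k₂))⁻¹ *
                P.eval (Real.log (M / ((c * g * k₂ : ℕ) : ℝ)) / Real.log M))) / ((c * g * k₂ : ℕ) : ℝ)) *
              (((k₁.divisors.card : ℝ) *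
                  (3 * (∑ q ∈ k₁.primeFactors, Real.log q ^ 2) ^ 2 - 2 * ∑ q ∈ k₁.primeFactors, Real.log q ^ 4) *
                  Real.log (M / ((c * g : ℕ) : ℝ) / k₁) ^ i) *
                ((k₂.divisors.card : ℝ) * Real.log (M / ((c * g : ℕ) : ℝ) / k₂) ^ (j - i)) *
                (lam * Real.log M - Real.log g - Real.log (M / ((c * g : ℕ) : ℝ))) ^ (m - j))| ≤
        (∑ i ∈ Finset.range (j + 1), (m.choose j : ℝ) * (j.choose i : ℝ) * 2 ^ (m - j) * Cb j i) * Real.log M ^ m := by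
    intro j hj
    have hjm : j ≤ m := Nat.lt_succ_iff.1 (Finset.mem_range.1 hj)
    rw [Finset.sum_mul]
    refine (Finset.abs_sum_le_sum_abs _ _).trans (Finset.sum_le_sum fun i hi ↦ ?_)
    have hij : i ≤ j := Nat.lt_succ_iff.1 (Finset.mem_range.1 hi)
    have e : (m - j) + i + (j - i) = m := by omega
    have h := hCb j i M hM
    rw [e] at h
    rw [abs_mul, abs_of_nonneg (by positivity : (0 : ℝ) ≤ (m.choose j : ℝ) * (j.choose i : ℝ) * 2 ^ (m - j)),
      mul_assoc ((m.choose j : ℝ) * (j.choose i : ℝ) * 2 ^ (m - j)) (Cb j i) (Real.log M ^ m)]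
    exact mul_le_mul_of_nonneg_left h (by positivity)
  refine (Finset.abs_sum_le_sum_abs _ _).trans ((Finset.sum_le_sum hterm).trans ?_)
  rw [← Finset.sum_mul, ← hK]
  gcongr; linarith

/-- **The mirror `|Sel(τ(k₁)·τ(3P₂²−2P₄)(k₂)·L^m)| ≤ C·log^m M`** (decoration on the second variable), by the
`k₁ ↔ k₂` symmetry of the Selberg form. [cite: KowalskiMichelVanderKam2000, (23)–(28) — derivation] -/
theorem abs_selbergM4Lpow_le' (P : ℝ[X]) (hP0 : P.coeff 0 = 0) (hP1 : P.coeff 1 = 0) (m : ℕ)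
    {lam : ℝ} (hlam0 : 0 ≤ lam) (hlam1 : lam ≤ 1) :
    ∃ C : ℝ, 0 < C ∧ ∀ M : ℝ, 3 ≤ M →
      |∑ c ∈ Icc 1 ⌊M⌋₊, ∑ g ∈ Icc 1 (⌊M⌋₊ / c), (μ g : ℝ) * c *
          ∑ k₁ ∈ Icc 1 (⌊M⌋₊ / (c * g)), ∑ k₂ ∈ Icc 1 (⌊M⌋₊ / (c * g)),
            ((μ (c * g * k₁) : ℝ) * ((psi (c * g * k₁))⁻¹ *
                P.eval (Real.log (M / ((c * g * k₁ : ℕ) : ℝ)) / Real.log M))) / ((c * g * k₁ : ℕ) : ℝ) *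
              (((μ (c * g * k₂) : ℝ) * ((psi (c * g * k₂))⁻¹ *
                P.eval (Real.log (M / ((c * g * k₂ : ℕ) : ℝ)) / Real.log M))) / ((c * g * k₂ : ℕ) : ℝ)) *
              ((k₁.divisors.card : ℝ) * ((k₂.divisors.card : ℝ) *
                (3 * (∑ p ∈ k₂.primeFactors, Real.log p ^ 2) ^ 2 - 2 * ∑ p ∈ k₂.primeFactors, Real.log p ^ 4)) *
                (2 * (lam * Real.log M) - 2 * Real.log g - Real.log k₁ - Real.log k₂) ^ m)| ≤
        C * Real.log M ^ m := by
  obtain ⟨C, hC, h⟩ := abs_selbergM4Lpow_le P hP0 hP1 m hlam0 hlam1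
  refine ⟨C, hC, fun M hM ↦ ?_⟩
  have hswap : ∀ c g : ℕ, ∑ k₁ ∈ Icc 1 (⌊M⌋₊ / (c * g)), ∑ k₂ ∈ Icc 1 (⌊M⌋₊ / (c * g)),
      ((μ (c * g * k₁) : ℝ) * ((psi (c * g * k₁))⁻¹ *
          P.eval (Real.log (M / ((c * g * k₁ : ℕ) : ℝ)) / Real.log M))) / ((c * g * k₁ : ℕ) : ℝ) *
        (((μ (c * g * k₂) : ℝ) * ((psi (c * g * k₂))⁻¹ *
          P.eval (Real.log (M / ((c * g * k₂ : ℕ) : ℝ)) / Real.log M))) / ((c * g * k₂ : ℕ) : ℝ)) *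
        ((k₁.divisors.card : ℝ) * ((k₂.divisors.card : ℝ) *
                (3 * (∑ p ∈ k₂.primeFactors, Real.log p ^ 2) ^ 2 - 2 * ∑ p ∈ k₂.primeFactors, Real.log p ^ 4)) *
                (2 * (lam * Real.log M) - 2 * Real.log g - Real.log k₁ - Real.log k₂) ^ m) =
      ∑ k₁ ∈ Icc 1 (⌊M⌋₊ / (c * g)), ∑ k₂ ∈ Icc 1 (⌊M⌋₊ / (c * g)),
      ((μ (c * g * k₁) : ℝ) * ((psi (c * g * k₁))⁻¹ *
          P.eval (Real.log (M / ((c * g * k₁ : ℕ) : ℝ)) / Real.log M))) / ((c * g * k₁ : ℕ) : ℝ) *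
        (((μ (c * g * k₂) : ℝ) * ((psi (c * g * k₂))⁻¹ *
          P.eval (Real.log (M / ((c * g * k₂ : ℕ) : ℝ)) / Real.log M))) / ((c * g * k₂ : ℕ) : ℝ)) *
        ((k₁.divisors.card : ℝ) * (3 * (∑ p ∈ k₁.primeFactors, Real.log p ^ 2) ^ 2 - 2 * ∑ p ∈ k₁.primeFactors, Real.log p ^ 4) *
                (k₂.divisors.card : ℝ) * (2 * (lam * Real.log M) - 2 * Real.log g - Real.log k₁ - Real.log k₂) ^ m) := by
    intro c g
    rw [Finset.sum_comm]
    refine Finset.sum_congr rfl fun k₁ _ ↦ Finset.sum_congr rfl fun k₂ _ ↦ ?_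
    rw [show 2 * (lam * Real.log M) - 2 * Real.log g - Real.log k₂ - Real.log k₁ =
      2 * (lam * Real.log M) - 2 * Real.log g - Real.log k₁ - Real.log k₂ by ring]
    ring
  rw [Finset.sum_congr rfl fun c _ ↦ Finset.sum_congr rfl fun g _ ↦ congrArg _ (hswap c g)]
  exact h M hM

/-- **(M4): the four `M₄`-family bounds of `…DiagDecorOrderTwoTwoPoly`** (`m ≤ 1`, `|·| ≤ C·log M`; from
`abs_selbergM4Lpow_le(')` and `log^m M ≤ log M` for `m ≤ 1`, `M ≥ 3`). [cite: KowalskiMichelVanderKam2000, (23)–(28) — derivation] -/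
theorem M4_bounds : ∀ P : ℝ[X], P.coeff 0 = 0 → P.coeff 1 = 0 → ∀ lam : ℝ, 0 ≤ lam → lam ≤ 1 → ∀ m : ℕ, m ≤ 1 →
      (∃ C : ℝ, ∀ M : ℝ, 3 ≤ M →
      |∑ c ∈ Icc 1 ⌊M⌋₊, ∑ g ∈ Icc 1 (⌊M⌋₊ / c), (μ g : ℝ) * c *
        ∑ k₁ ∈ Icc 1 (⌊M⌋₊ / (c * g)), ∑ k₂ ∈ Icc 1 (⌊M⌋₊ / (c * g)),
          ((μ (c * g * k₁) : ℝ) * ((psi (c * g * k₁))⁻¹ *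
              P.eval (Real.log (M / ((c * g * k₁ : ℕ) : ℝ)) / Real.log M)) / ((c * g * k₁ : ℕ) : ℝ)) *
            ((μ (c * g * k₂) : ℝ) * ((psi (c * g * k₂))⁻¹ *
              P.eval (Real.log (M / ((c * g * k₂ : ℕ) : ℝ)) / Real.log M)) / ((c * g * k₂ : ℕ) : ℝ)) *
            ((k₁.divisors.card : ℝ) * (3 * (∑ p ∈ k₁.primeFactors, Real.log p ^ 2) ^ 2 - 2 * ∑ p ∈ k₁.primeFactors, Real.log p ^ 4) *
                (k₂.divisors.card : ℝ) * (2 * (lam * Real.log M) - 2 * Real.log g - Real.log k₁ - Real.log k₂) ^ m)| ≤ C * Real.log M) ∧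
      (∃ C : ℝ, ∀ M : ℝ, 3 ≤ M →
      |∑ c ∈ Icc 1 ⌊M⌋₊, ∑ g ∈ Icc 1 (⌊M⌋₊ / c), (μ g : ℝ) * c *
        ∑ k₁ ∈ Icc 1 (⌊M⌋₊ / (c * g)), ∑ k₂ ∈ Icc 1 (⌊M⌋₊ / (c * g)),
          ((μ (c * g * k₁) : ℝ) * ((psi (c * g * k₁))⁻¹ *
              P.eval (Real.log (M / ((c * g * k₁ : ℕ) : ℝ)) / Real.log M)) / ((c * g * k₁ : ℕ) : ℝ)) *
            ((μ (c * g * k₂) : ℝ) * ((psi (c * g * k₂))⁻¹ *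
              P.eval (Real.log (M / ((c * g * k₂ : ℕ) : ℝ)) / Real.log M)) / ((c * g * k₂ : ℕ) : ℝ)) *
            ((k₁.divisors.card : ℝ) * ((k₂.divisors.card : ℝ) *
                (3 * (∑ p ∈ k₂.primeFactors, Real.log p ^ 2) ^ 2 - 2 * ∑ p ∈ k₂.primeFactors, Real.log p ^ 4)) *
                (2 * (lam * Real.log M) - 2 * Real.log g - Real.log k₁ - Real.log k₂) ^ m)| ≤ C * Real.log M) := by
  intro P hP0 hP1 lam hlam0 hlam1 m hm
  have hpow : ∀ M : ℝ, 3 ≤ M → Real.log M ^ m ≤ Real.log M := fun M hM ↦ by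
    have hℓ1 : 1 ≤ Real.log M := one_le_log_of_three_le hM
    interval_cases m
    · rw [pow_zero]; exact hℓ1
    · rw [pow_one]
  refine ⟨?_, ?_⟩
  · obtain ⟨C, hC, h⟩ := abs_selbergM4Lpow_le P hP0 hP1 m hlam0 hlam1
    exact ⟨C, fun M hM ↦ (h M hM).trans (mul_le_mul_of_nonneg_left (hpow M hM) hC.le)⟩
  · obtain ⟨C, hC, h⟩ := abs_selbergM4Lpow_le' P hP0 hP1 m hlam0 hlam1
    exact ⟨C, fun M hM ↦ (h M hM).trans (mul_le_mul_of_nonneg_left (hpow M hM) hC.le)⟩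

end Summit.Parity.GeneralizedHardyLittlewood.Theorems.MomentsBeyondDiagonal.DiagKernel

end
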